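/-
Copyright (c) 2026 the pub-hodgecm-mathlib formalisation cell (harness21).  Prover seat hodgecm-mathlib-B-p10 (g26) — ROAD W owner (heir of B-p14 (g32)), 2026-09-01.
«EP-ROAD-W TREE JUNCTION»: the letter (R2) from, at every ramified non-split place, ONE tree action of the one-place model `U_w` with Kottwitz's vertex∕edge stabilisers
(either type) and the non-elliptic relation (N).
-/
import Literature.NumberTheory.Rogawski1990.RankOneEulerPoincareNonsplitOfRamifiedRelations          -- ★ (B-p10 g26) p843786: `rankOneEulerPoincareNonsplit_of_ramified_relations`
import Literature.NumberTheory.Rogawski1990.RankOneEulerPoincareNonsplitRamifiedEllipticOfTreeAction  -- ★ (B-p14 g32) p843743: (E) from a tree action, `_local` ∕ `_local'`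
import HarnessLib

/-!
# The rank-one Euler–Poincaré letter (R2) from ONE tree action per ramified place — the ROAD W tree junction

Topic `NumberTheory/Rogawski1990`, namespace `Literature.NumberTheory.Rogawski1990`.  ONE THEOREM: no definition, no named fact, no instance, no notation, no `sorry`; kernel lane.
Cell `pub/hodgecm-mathlib` (D-0151), crux H413 = `stmt-HodgeConjecture-24833`, line «N6nsGerm», stub `stub_N6nsR2EP : RankOneEulerPoincareNonsplit` (pen F0P2-p02 (g9)); ROAD W
(«R2EP-wild», F0P3a-p04 (g13) MEMO; owner B-p14 (g32) → B-p10 (g26)).  HONEST LABEL: HC_CM is proved only modulo the cell's remaining named inputs (hLiu418, h413) until rung 0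
closes; this file is unconditional, (R2) is a PRINTED theorem [Kottwitz1988, §2 Thm. 2].

THE TREE JUNCTION (second statement-first layer of the ROAD W FOLD; ★ inputs only).  ★ `rankOneEulerPoincareNonsplit_of_ramified_relations` (p843786) wants, per ramified non-split
`w`, a `D ∈ GL₂(L_w)` with the relations (E) and (N) at `(K♯_D, K, K♯_D ⊓ K)`; ★ B-p14 `epEllipticRelation_vertexEdgeLevels_of_vertexAction_local{,'}` (p843743) give (E) from ANY
action `act` of the one-place group `U_w = U(σ_w, (Φ₂)_w)` on a tree — `act 1 = id`, `act (uu') = act u ∘ act u'`, adjacency preserved, transitive on vertices and on darts from a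
base dart `(x₀, x₁)` — whose vertex ∕ edge stabilisers are read through `GL₂(𝒪_w)` and `D GL₂(𝒪_w) D⁻¹` in EITHER order: type `√π` (`K♯_D` fixes `x₀`, `K` fixes the edge
`{x₀,x₁}`) or type `√u` (`K` fixes `x₀`, `K♯_D` the edge).  HENCE **`rankOneEulerPoincareNonsplit_of_treeActions`**: if at every non-split `v` RAMIFIED in `L` (`e(w|v) ≠ 1`) there
are such a tree action, a `D`, the stabiliser identifications of ONE of the two types, and the NON-ELLIPTIC relation (N) at `(K♯_D, K, K♯_D ⊓ K)` (tokens of ★ p843499 VERBATIM, for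
every two-sided Haar `ν` and canonical `m`), then `RankOneEulerPoincareNonsplit`.  The road's last files plug in by `exact`: the action and its transitivity = B-p08 (g28)
(W1c-B) `rhoVertexAct(Place)` (★ p843783 + place wrapper), the stabiliser iffs = F0P3a-p04 (g14) (W2) assembly (★ p843787∕p843800 core), the type and `D = diag(1, η)` from ★
B-p14 p843768's anti-fixed `α`, (N) = A-p06 (g28) (W6-N) (★ F0P2-p02 THEOREM C p843769 per period).  No `IsUnit 2`: wild places ride.

## References
* [Kottwitz1988] R. E. Kottwitz, *Tamagawa numbers*, Ann. of Math. 127 (1988), 629–646, §2 Theorem 2.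
* [Rogawski1990] J. D. Rogawski, *Automorphic Representations of Unitary Groups in Three Variables* (1990), §12.6 p. 174; §12.7 Lemma 12.7.1 p. 176.
* [Serre1980Trees] J.-P. Serre, *Trees* (1980), Ch. II §1.1–§1.3.
* [Tits1979] J. Tits, *Reductive groups over local fields*, PSPM 33.1 (1979), §2.7.
-/

set_option autoImplicit false

noncomputable section

open scoped ValuativeRel Matrix MatrixGroups
open Matrix ValuativeRel NumberField IsDedekindDomain MulAction MeasureTheory Measure

namespace Literature.NumberTheory.Rogawski1990

open Literature.NumberTheory.Automorphic Literature.NumberTheory.Automorphic.UnitaryGroup Literature.NumberTheory.GaloisRepresentations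

/-- **(R2) FROM ONE TREE ACTION PER RAMIFIED PLACE — THE ROAD W TREE JUNCTION.**  See the module docstring: per ramified non-split `w`, a tree `X` on a vertex type `W`, an action
`act` of `U_w` on `W` (unit, multiplicative, adjacency-preserving, vertex- and dart-transitive from a base dart `(x₀, x₁)`), a `D ∈ GL₂(L_w)`, the stabiliser identifications of
type `√π` (`D GL₂(𝒪_w) D⁻¹ ↔` fixing `x₀`, `GL₂(𝒪_w) ↔` fixing the edge) OR of type `√u` (swapped), and the non-elliptic relation (N) at `(K♯_D, K, K♯_D ⊓ K)` for every Haar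
`ν` and canonical `m` ⇒ the letter. [cite: Kottwitz1988, §2 Theorem 2] [cite: Rogawski1990, §12.6 p. 174; §12.7 Lemma 12.7.1 p. 176] [cite: Serre1980Trees, II.1.3] [cite: Tits1979, §2.7] -/
theorem rankOneEulerPoincareNonsplit_of_treeActions
    (hT : ∀ (L : Type) [Field L] [NumberField L] [IsCMField L] (v : HeightOneSpectrum (𝓞 ↥(maximalRealSubfield L)))
      (w : UnitaryGroup.PlacesOver L v) (hw : IsCMField.complexConj L • w.1 = w.1),
      v.asIdeal.ramificationIdx' w.1.asIdeal ≠ 1 →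
      ∃ (W : Type) (X : SimpleGraph W) (_ : X.IsTree)
        (act : ↥(unitaryGroupOfForm (galAdicCompletionMap (L := L) (IsCMField.complexConj L) hw) (placeForm (Matrix.of fun i j : Fin 2 => if i.val + j.val + 1 = 2 then (1 : L) else 0) w.1)) → W → W)
        (_ : ∀ x : W, act 1 x = x)
        (_ : ∀ (u u' : ↥(unitaryGroupOfForm (galAdicCompletionMap (L := L) (IsCMField.complexConj L) hw) (placeForm (Matrix.of fun i j : Fin 2 => if i.val + j.val + 1 = 2 then (1 : L) else 0) w.1))) (x : W), act (u * u') x = act u (act u' x))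
        (_ : ∀ (u : ↥(unitaryGroupOfForm (galAdicCompletionMap (L := L) (IsCMField.complexConj L) hw) (placeForm (Matrix.of fun i j : Fin 2 => if i.val + j.val + 1 = 2 then (1 : L) else 0) w.1))) (a b : W), X.Adj (act u a) (act u b) ↔ X.Adj a b)
        (x₀ x₁ : W) (_ : X.Adj x₀ x₁)
        (_ : ∀ x : W, ∃ u : ↥(unitaryGroupOfForm (galAdicCompletionMap (L := L) (IsCMField.complexConj L) hw) (placeForm (Matrix.of fun i j : Fin 2 => if i.val + j.val + 1 = 2 then (1 : L) else 0) w.1)), act u x₀ = x)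
        (_ : ∀ a b : W, X.Adj a b → ∃ u : ↥(unitaryGroupOfForm (galAdicCompletionMap (L := L) (IsCMField.complexConj L) hw) (placeForm (Matrix.of fun i j : Fin 2 => if i.val + j.val + 1 = 2 then (1 : L) else 0) w.1)), act u x₀ = a ∧ act u x₁ = b)
        (D : GL (Fin 2) (w.1.adicCompletion L)),
        (((∀ u : ↥(unitaryGroupOfForm (galAdicCompletionMap (L := L) (IsCMField.complexConj L) hw) (placeForm (Matrix.of fun i j : Fin 2 => if i.val + j.val + 1 = 2 then (1 : L) else 0) w.1)), (u : GL (Fin 2) (w.1.adicCompletion L)) ∈ (glInt 2 (w.1.adicCompletion L)).map (MulAut.conj D).toMonoidHom ↔ act u x₀ = x₀) ∧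
           (∀ u : ↥(unitaryGroupOfForm (galAdicCompletionMap (L := L) (IsCMField.complexConj L) hw) (placeForm (Matrix.of fun i j : Fin 2 => if i.val + j.val + 1 = 2 then (1 : L) else 0) w.1)), (u : GL (Fin 2) (w.1.adicCompletion L)) ∈ glInt 2 (w.1.adicCompletion L) ↔ s(act u x₀, act u x₁) = s(x₀, x₁))) ∨
          ((∀ u : ↥(unitaryGroupOfForm (galAdicCompletionMap (L := L) (IsCMField.complexConj L) hw) (placeForm (Matrix.of fun i j : Fin 2 => if i.val + j.val + 1 = 2 then (1 : L) else 0) w.1)), (u : GL (Fin 2) (w.1.adicCompletion L)) ∈ glInt 2 (w.1.adicCompletion L) ↔ act u x₀ = x₀) ∧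
           (∀ u : ↥(unitaryGroupOfForm (galAdicCompletionMap (L := L) (IsCMField.complexConj L) hw) (placeForm (Matrix.of fun i j : Fin 2 => if i.val + j.val + 1 = 2 then (1 : L) else 0) w.1)), (u : GL (Fin 2) (w.1.adicCompletion L)) ∈ (glInt 2 (w.1.adicCompletion L)).map (MulAut.conj D).toMonoidHom ↔ s(act u x₀, act u x₁) = s(x₀, x₁)))) ∧
          (∀ [MeasurableSpace ((UnitaryGroup.cmDatum L 2 (Matrix.of fun i j : Fin 2 => if i.val + j.val + 1 = 2 then (1 : L) else 0)).Local v)]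
            [BorelSpace ((UnitaryGroup.cmDatum L 2 (Matrix.of fun i j : Fin 2 => if i.val + j.val + 1 = 2 then (1 : L) else 0)).Local v)]
            (ν : Measure ((UnitaryGroup.cmDatum L 2 (Matrix.of fun i j : Fin 2 => if i.val + j.val + 1 = 2 then (1 : L) else 0)).Local v))
            [ν.IsHaarMeasure] [ν.IsMulRightInvariant]
            [_iZ : ∀ γ : (UnitaryGroup.cmDatum L 2 (Matrix.of fun i j : Fin 2 => if i.val + j.val + 1 = 2 then (1 : L) else 0)).Local v,
              MeasurableSpace (((UnitaryGroup.cmDatum L 2 (Matrix.of fun i j : Fin 2 => if i.val + j.val + 1 = 2 then (1 : L) else 0)).Local v) ⧸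
                Subgroup.centralizer ({γ} : Set ((UnitaryGroup.cmDatum L 2 (Matrix.of fun i j : Fin 2 => if i.val + j.val + 1 = 2 then (1 : L) else 0)).Local v)))]
            [_bZ : ∀ γ : (UnitaryGroup.cmDatum L 2 (Matrix.of fun i j : Fin 2 => if i.val + j.val + 1 = 2 then (1 : L) else 0)).Local v,
              BorelSpace (((UnitaryGroup.cmDatum L 2 (Matrix.of fun i j : Fin 2 => if i.val + j.val + 1 = 2 then (1 : L) else 0)).Local v) ⧸
                Subgroup.centralizer ({γ} : Set ((UnitaryGroup.cmDatum L 2 (Matrix.of fun i j : Fin 2 => if i.val + j.val + 1 = 2 then (1 : L) else 0)).Local v)))]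
            (m : OrbitalMeasureFamily ((UnitaryGroup.cmDatum L 2 (Matrix.of fun i j : Fin 2 => if i.val + j.val + 1 = 2 then (1 : L) else 0)).Local v)),
            m.IsCanonical (fun γ => IsRegularElt (γ.val : GL (Fin 2) (UnitaryGroup.LocalRing L v))) ν →
            ∀ γ : (cmDatum L 2 (Matrix.of fun i j : Fin 2 => if i.val + j.val + 1 = 2 then (1 : L) else 0)).Local v,
      IsRegularElt (γ.val : GL (Fin 2) (UnitaryGroup.LocalRing L v)) →
      ¬ CompactSpace (Subgroup.centralizer ({γ} : Set ((cmDatum L 2 (Matrix.of fun i j : Fin 2 => if i.val + j.val + 1 = 2 then (1 : L) else 0)).Local v))) →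
      (((ν ((((glInt 2 (w.1.adicCompletion L)).map (MulAut.conj D).toMonoidHom).comap
          (((unitaryGroupOfForm (galAdicCompletionMap (L := L) (IsCMField.complexConj L) hw)
            (placeForm (Matrix.of fun i j : Fin 2 => if i.val + j.val + 1 = 2 then (1 : L) else 0) w.1)).subtype.comp
            (localNonsplitEquiv (IsCMField.complexConj L) (Matrix.of fun i j : Fin 2 => if i.val + j.val + 1 = 2 then (1 : L) else 0)
          (IsCMField.complexConj_ne_one L) w hw).toMonoidHom :
            (cmDatum L 2 (Matrix.of fun i j : Fin 2 => if i.val + j.val + 1 = 2 then (1 : L) else 0)).Local v →* GL (Fin 2) (w.1.adicCompletion L)))))).toReal : ℂ))⁻¹ *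
          classOrbitalIntegral m
            ((((((glInt 2 (w.1.adicCompletion L)).map (MulAut.conj D).toMonoidHom).comap
          (((unitaryGroupOfForm (galAdicCompletionMap (L := L) (IsCMField.complexConj L) hw)
            (placeForm (Matrix.of fun i j : Fin 2 => if i.val + j.val + 1 = 2 then (1 : L) else 0) w.1)).subtype.comp
            (localNonsplitEquiv (IsCMField.complexConj L) (Matrix.of fun i j : Fin 2 => if i.val + j.val + 1 = 2 then (1 : L) else 0)
          (IsCMField.complexConj_ne_one L) w hw).toMonoidHom :
            (cmDatum L 2 (Matrix.of fun i j : Fin 2 => if i.val + j.val + 1 = 2 then (1 : L) else 0)).Local v →* GL (Fin 2) (w.1.adicCompletion L)))) : Subgroup ((cmDatum L 2 (Matrix.of fun i j : Fin 2 => if i.val + j.val + 1 = 2 then (1 : L) else 0)).Local v)) : Set ((cmDatum L 2 (Matrix.of fun i j : Fin 2 => if i.val + j.val + 1 = 2 then (1 : L) else 0)).Local v)).indicator fun _ => (1 : ℂ))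
            (ConjClasses.mk γ) +
        (((ν (cmLocalIntegralLevel L 2 (Matrix.of fun i j : Fin 2 => if i.val + j.val + 1 = 2 then (1 : L) else 0) v)).toReal : ℂ))⁻¹ *
          classOrbitalIntegral m
            (((cmLocalIntegralLevel L 2 (Matrix.of fun i j : Fin 2 => if i.val + j.val + 1 = 2 then (1 : L) else 0) v) : Set ((cmDatum L 2 (Matrix.of fun i j : Fin 2 => if i.val + j.val + 1 = 2 then (1 : L) else 0)).Local v)).indicator fun _ => (1 : ℂ))
            (ConjClasses.mk γ) -
        (((ν ((((glInt 2 (w.1.adicCompletion L)).map (MulAut.conj D).toMonoidHom).comap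
          (((unitaryGroupOfForm (galAdicCompletionMap (L := L) (IsCMField.complexConj L) hw)
            (placeForm (Matrix.of fun i j : Fin 2 => if i.val + j.val + 1 = 2 then (1 : L) else 0) w.1)).subtype.comp
            (localNonsplitEquiv (IsCMField.complexConj L) (Matrix.of fun i j : Fin 2 => if i.val + j.val + 1 = 2 then (1 : L) else 0)
          (IsCMField.complexConj_ne_one L) w hw).toMonoidHom :
            (cmDatum L 2 (Matrix.of fun i j : Fin 2 => if i.val + j.val + 1 = 2 then (1 : L) else 0)).Local v →* GL (Fin 2) (w.1.adicCompletion L)))) ⊓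
            cmLocalIntegralLevel L 2 (Matrix.of fun i j : Fin 2 => if i.val + j.val + 1 = 2 then (1 : L) else 0) v)).toReal : ℂ))⁻¹ *
          classOrbitalIntegral m
            ((((((glInt 2 (w.1.adicCompletion L)).map (MulAut.conj D).toMonoidHom).comap
          (((unitaryGroupOfForm (galAdicCompletionMap (L := L) (IsCMField.complexConj L) hw)
            (placeForm (Matrix.of fun i j : Fin 2 => if i.val + j.val + 1 = 2 then (1 : L) else 0) w.1)).subtype.comp
            (localNonsplitEquiv (IsCMField.complexConj L) (Matrix.of fun i j : Fin 2 => if i.val + j.val + 1 = 2 then (1 : L) else 0)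
          (IsCMField.complexConj_ne_one L) w hw).toMonoidHom :
            (cmDatum L 2 (Matrix.of fun i j : Fin 2 => if i.val + j.val + 1 = 2 then (1 : L) else 0)).Local v →* GL (Fin 2) (w.1.adicCompletion L)))) ⊓
              cmLocalIntegralLevel L 2 (Matrix.of fun i j : Fin 2 => if i.val + j.val + 1 = 2 then (1 : L) else 0) v : Subgroup ((cmDatum L 2 (Matrix.of fun i j : Fin 2 => if i.val + j.val + 1 = 2 then (1 : L) else 0)).Local v)) : Set ((cmDatum L 2 (Matrix.of fun i j : Fin 2 => if i.val + j.val + 1 = 2 then (1 : L) else 0)).Local v)).indicator fun _ => (1 : ℂ))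
            (ConjClasses.mk γ) = 0)) :
    RankOneEulerPoincareNonsplit := by
  refine rankOneEulerPoincareNonsplit_of_ramified_relations (fun L _ _ _ v w hw he => ?_)
  obtain ⟨W, X, hX, act, act_one, act_mul, act_adj, x₀, x₁, h01, hV, hD, D, hstab, hN⟩ := hT L v w hw he
  refine ⟨D, ?_, fun ν _ _ _ _ m hm => hN ν m hm⟩
  rcases hstab with ⟨hKv, hKe⟩ | ⟨hKv, hKe⟩
  · exact fun γ hreg hc => epEllipticRelation_vertexEdgeLevels_of_vertexAction_local L w hw D hX act act_one act_mul act_adj h01 hV hD hKv hKe γ hreg hc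
  · exact fun γ hreg hc => epEllipticRelation_vertexEdgeLevels_of_vertexAction_local' L w hw D hX act act_one act_mul act_adj h01 hV hD hKv hKe γ hreg hc

end Literature.NumberTheory.Rogawski1990

end
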